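/-
Copyright (c) 2026 the pub-hodgecm-mathlib formalisation cell (harness21).  Prover seat hodgecm-mathlib-LH4-p01 (g12): road M6 → F5 → dyadic chain of `stub_DyUnramCore` (D-UNR),
site (L2-3) «THE WALL» — the (I) ASSEMBLY `liftInterior_of_levelTwo_of_isUnramifiedIn` over the θ-road (LH10-p01 (g12) MEMO-L23-θSHIFT ∕ CENSUS-L23-CM v1; LEAD T15-55); 2026-09-03.
-/
import Literature.NumberTheory.Rogawski1990.LevelTwoLiftInterior                        -- ★ ORGAN (I) tame (pattern; brings every type-free ∕ 2-free head it folds: ★ p846532 `exists_levelOne_piece_boundary`, ★ `exists_nhds_one_twoDeep_endoEmbLocal`, ★ `setOf_entrywise_deep_mem_nhds_one`, ★ `exists_flicker_exponents_split`, ★ type-(1) S-rows ∕ compactness, ★ `valuation_quadratic_bounds_of_entrywise_deep`, …)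
import Literature.NumberTheory.Automorphic.UnitaryCarrierCongruenceNhdsBasisHermitian        -- ★ p853675 (this seat) ROW 1 N5b-θ: `exists_level_forall_hermitianShift_mem_of_mem_nhds_one`
import Literature.NumberTheory.Automorphic.LevelTwoInteriorOrbitalTransportHermitian        -- ★ p853715 (this seat) ROW 3 N3-θ: `classOrbitalIntegral_levelOneIndicator_eq_hermitianShift`; brings ★ p853684 (A3)-θ `finsum_finExplicitCollection_Δ_mul_eq_inv_sq_mul_finsum_hermitianShift`, ★ p853677 «CM-SHIFT-θ»
import Literature.NumberTheory.Rogawski1990.DepthZeroTransferHValuesShiftAffine            -- ★ p853676 (this seat) ROW 8: `stableOrbitalIntegralRel_chi_shift_of_not_exists_isRoot_affine`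
import Literature.NumberTheory.Rogawski1990.TypeTwoHermitianShiftDeepDenominators         -- ★ p853717 (LH10-p01 (g13)): `isUnit_hermitianShift_denominators_of_twoDeep` (type-free, 2-deepness only)
import Literature.NumberTheory.Rogawski1990.TypeOneHermitianShiftBindersCM                 -- ★ (LH7-p04 (g13)) ROW 2: `hermitianShifted_binders_of_typeOne`, `not_levi_of_hermitianShift`
import Literature.NumberTheory.Rogawski1990.TypeTwoHermitianShiftBindersNoDiscCM           -- ★ (LH7-p04 (g13)) ROW 5, `hN`-free: `hermitianShifted_binders_of_typeTwo_of_valued_denominators`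
import Literature.NumberTheory.Automorphic.TypeTwoHermitianMoebiusShiftCentre              -- ★ p853726 (LH10-p01 (g13)) «CENTRE-SHIFT-θ»: `hermitianMoebius_admissibleCentre`
import Literature.NumberTheory.Rogawski1990.DepthZeroTransferHValuesTypeTwoEisenstein      -- ★ p853490 (LH4-p01 (g11)): `exists_admissibleCentre_of_eisensteinBlock`, `v_le_one_of_v_sub_lt_one`
import Literature.NumberTheory.Rogawski1990.TypeTwoEisensteinDataAtPlace                   -- ★ p853493 (LH10-p01 (g12)) (P2d-α): `exists_eisensteinData_at_place`
import Literature.NumberTheory.Automorphic.UnitaryRankTwoCentralizerCompactness            -- ★ `compactSpace_centralizer_cmDatum_two_of_not_exists_isRoot` (any residue characteristic)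
import Literature.NumberTheory.Automorphic.UnitaryTypeTwoNormPairCentralizerCompactRamified -- ★ `compactSpace_centralizer_of_isLocalNormPair_of_not_exists_isRoot_nonsplit` (no `h2 ∕ hunr ∕ hint ∕ N`)
import Literature.NumberTheory.Automorphic.HeisenbergChartShearedAtNonsplitPlace           -- ★ L1 (LH7-p04 (g13)): `exists_conjLocal_add_self_eq_one` (the shear constant `θ`, `θ + σθ = 1`, `|θ_w| ≤ 1`, any residue characteristic)
import HarnessLib

/-!
# ORGAN (I) «LIFT — INTERIOR HALF» at EVERY unramified inert place: `liftInterior_of_levelTwo` with the `v ∤ 2` binder deleted, along the HERMITIAN Cayley shift `φ_θ`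
# (site (L2-3) «THE WALL» of the dyadic `…_le_two` fold; Rogawski 1990 §4.9, Kottwitz 1986 §3)

Topic `NumberTheory/Rogawski1990`; namespace `Literature.NumberTheory.Rogawski1990`.  THEOREMS ONLY (no definition, no instance, no notation, no named fact, no `sorry`); kernel
lane `--supports stmt-HodgeConjecture-24833`.  Cell `pub/hodgecm-mathlib` (D-0151), crux H413 = `stmt-HodgeConjecture-24833`; road M6 → F5 → the dyadic chain of organ
(D-UNR) `stub_DyUnramCore`, LEVEL TWO.  THE STATEMENT: ★ `liftInterior_of_levelTwo` (`LevelTwoLiftInterior` :62) with `(h2 : IsUnit (2 : 𝒪[w.1.adicCompletion L]))` DELETED,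
conclusion BYTE-IDENTICAL — the one open socket `stub_liftInterior_dy` of the dyadic fold (LH4-p01 (g12) skeleton 54303f0d, LEAD T15-55 «named site = organ (I) alone»).

THE PROOF = ★'s fold re-threaded along LH10-p01 (g12)'s θ-road (CENSUS-L23-CM v1 rows 1–8, fence «`φ_θ` everywhere»): the shear constant `θ` with `θ + σθ = 1`, `|θ_w| ≤ 1`
(★ L1) replaces `½`; `u_H = φ_θ(γ_H) = (θ•γ + (c−θ)•1)((c−σθ)•γ + σθ•1)⁻¹` componentwise (★ p853677 `exists_local_coe_eq_hermitianMoebius`); `u_H ∈ V′` by ROW 1 ★ p853675;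
the denominators are units by 2-DEEPNESS alone (★ p853717, type-free); `Δ = θσθ − (c−θ)(c−σθ) = c(1−c)` is a unit of `E_v` (replaces `4c`); TYPE (1): ★ ROW 2
`hermitianShifted_binders_of_typeOne` + `not_levi_of_hermitianShift`, the 2-free S-rows ★ `stableOrbitalIntegralRel_chi_shift_of_isRoot` and compactness ★
`…_of_isLocalNormPair_of_isRoot`; TYPE (2), REWORKED IN EISENSTEIN-CENTRE CURRENCY (the discriminant exponent `d + 2N` has either parity at `v ∣ 2`, so ★'s `hN` road is
closed): (P2d-α) ★ `exists_eisensteinData_at_place` ⇒ ★ g11 `exists_admissibleCentre_of_eisensteinBlock` (centre `(a, f, e′, N)` of `g_w`; `N ≥ 2` by 2-deepness, §1) ⇒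
★ p853726 `hermitianMoebius_admissibleCentre` (centre of `φ_θ(g_w)` at depth `N − 1`) ⇒ ROW 8 ★ p853676 (the two S-rows), binders ★ NoDisc
`hermitianShifted_binders_of_typeTwo_of_valued_denominators`, compactness ★ `compactSpace_centralizer_cmDatum_two_of_not_exists_isRoot` ∕ `…_nonsplit` (hypothesis-free);
both types close by (A3)-θ ★ p853684 `finsum_finExplicitCollection_Δ_mul_eq_inv_sq_mul_finsum_hermitianShift` with `hF` = N3-θ ★ p853715
`classOrbitalIntegral_levelOneIndicator_eq_hermitianShift`.
HONEST LABEL: HC_CM is proved only modulo the 7 printed citations (2 remaining: hLiu418 = stmt-HodgeConjecture-24832, h413 = stmt-HodgeConjecture-24833) until rung 0 closes;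
count-neutral: this closes the L2-3 socket of the dyadic level-two fold, not the crux, and moves no label until the desk prices the `stub_N6nsDyadic` rider.

* §1 `two_le_of_admissibleCentre_of_twoDeep` (generic valued field: an admissible centre of a 2-deep `g` has depth `N ≥ 2`);
* §2 **`liftInterior_of_levelTwo_of_isUnramifiedIn`**.

## References
* [Rogawski1990] J. D. Rogawski, *Automorphic Representations of Unitary Groups in Three Variables*, Ann. of Math. Stud. 123 (1990): §4.9 Prop. 4.9.1 (a)(b) p. 55, Lemma 4.9.3 p. 56;
  §4.3 (4.3.1)–(4.3.2) p. 43.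
* [Kottwitz1986BaseChangeUnits] R. E. Kottwitz, *Base change for unit elements of Hecke algebras*, Compositio Math. 60 (1986): §3.
* [LanglandsShelstad1990Descent] R. Langlands, D. Shelstad, *Descent for transfer factors*, The Grothendieck Festschrift II (1990): §2.1 (2.1.2).
* [SerreLocalFields1979] J.-P. Serre, *Local Fields*, GTM 67 (1979): Ch. I §6; Ch. V §2.
-/

set_option autoImplicit false

noncomputable section

open NumberField IsDedekindDomain MeasureTheory Measure Topology Filter Matrix Polynomial
open Literature.NumberTheory.Rogawski1990 Literature.NumberTheory.Automorphic Literature.NumberTheory.GaloisRepresentations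
open Literature.NumberTheory.Automorphic.UnitaryGroup Literature.NumberTheory.Automorphic.IntegralReduction Literature.NumberTheory.Automorphic.MoebiusShift
open Literature.NumberTheory.NumberFields
open Literature.AlgebraicGeometry.ShimuraVarieties (unitaryGroup hermForm)
open scoped Matrix MatrixGroups Classical ValuativeRel WithZero

namespace Literature.NumberTheory.Rogawski1990

/-! ## §1 An admissible centre of a 2-deep `g` has depth at least two -/

/-- **`N ≥ 2`**: if `g` is 2-DEEP (`|χ_g(1)| = |1 − tr g + det g| ≤ |c|⁴`) and `(a, f, e′, N)` is an admissible centre (`tr g − 2a = f`, `|f| ≤ |c|^{N+1}`, `χ_g(a) = −e′`,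
`|e′| = |c|^{2N+1}`), then `2 ≤ N`: with `y = 1 − a`, `y(y − f) = χ_g(1) + e′`; for `N ≤ 1` the right side has ODD valuation `2N+1 ≤ 3 < 4`, while the left side is
`|y|²` (even) when `|y| > |f|` and `≤ |c|^{2N+2}` otherwise. [cite: SerreLocalFields1979, Ch. I §6] [cite: Kottwitz1986BaseChangeUnits, §3] -/
theorem two_le_of_admissibleCentre_of_twoDeep {K : Type*} [Field K] [Valued K ℤᵐ⁰] {c : K} (hc : Valued.v c = WithZero.exp (-1 : ℤ))
    (g : Matrix (Fin 2) (Fin 2) K) (hchi : Valued.v ((1 : K) - g.trace + g.det) ≤ Valued.v c ^ 4)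
    {a f e' : K} {N : ℕ} (hf : Valued.v f ≤ Valued.v c ^ (N + 1)) (he : Valued.v e' = Valued.v c ^ (2 * N + 1))
    (htf : g.trace - 2 * a = f) (hde : a * a - g.trace * a + g.det = -e') : 2 ≤ N := by
  have hcpow := valued_pow_of_valued_eq_exp_neg_one hc
  by_contra hN
  have hN1 : N ≤ 1 := by omega
  -- the right side `χ_g(1) + e′` has valuation `exp(−(2N+1))`
  have key : (1 - a) * ((1 - a) - f) = ((1 : K) - g.trace + g.det) + e' := by rw [← htf]; linear_combination -hde
  have hlt : Valued.v ((1 : K) - g.trace + g.det) < Valued.v e' := by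
    refine lt_of_le_of_lt hchi ?_
    rw [he, hcpow, hcpow]; exact WithZero.exp_lt_exp.2 (by push_cast; omega)
  have hR : Valued.v (((1 : K) - g.trace + g.det) + e') = WithZero.exp (-((2 * N + 1 : ℕ) : ℤ)) := by
    rw [Valuation.map_add_eq_of_lt_right _ hlt, he, hcpow]
  rw [← key, map_mul] at hR
  by_cases hyf : Valued.v f < Valued.v (1 - a)
  · -- `|y − f| = |y|`: even valuation
    rw [Valuation.map_sub_eq_of_lt_left _ hyf] at hR
    have hy0 : Valued.v (1 - a) ≠ 0 := fun h0 => by rw [h0, mul_zero] at hR; exact WithZero.zero_ne_coe hR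
    obtain ⟨m, hm⟩ : ∃ m : ℤ, Valued.v (1 - a) = WithZero.exp m := ⟨WithZero.log (Valued.v (1 - a)), (WithZero.exp_log hy0).symm⟩
    rw [hm, ← WithZero.exp_add] at hR
    have h := WithZero.exp_injective hR
    omega
  · -- `|y| ≤ |f| ≤ |c|^{N+1}`: too small
    have hy : Valued.v (1 - a) ≤ Valued.v c ^ (N + 1) := (not_lt.1 hyf).trans hf
    have hyf' : Valued.v ((1 - a) - f) ≤ Valued.v c ^ (N + 1) := (Valuation.map_sub _ _ _).trans (max_le hy hf)
    have hle : Valued.v (1 - a) * Valued.v ((1 - a) - f) ≤ Valued.v c ^ (N + 1) * Valued.v c ^ (N + 1) := mul_le_mul' hy hyf'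
    rw [hR, hcpow, ← WithZero.exp_add, WithZero.exp_le_exp] at hle
    push_cast at hle
    omega

/-! ## §2 The organ -/

set_option maxHeartbeats 3200000 in
-- the socket statement and the two-branch assembly carry the large CM-place tokens (★'s budget × 2: the type-(2) branch runs the centre road); no search tactic runs long here
/-- **ORGAN I «LIFT — INTERIOR HALF», 2-FREE** (★ `liftInterior_of_levelTwo`'s binders with `h2` DELETED, conclusion BYTE-IDENTICAL; END fold `…HyperspecialLevelTwo` v3.5 :530): given the interior values `c′` of a level-2 `K`-class piece `g`, the canonical
level-1 strata piece `g′` with values `c′` (★ `exists_levelOne_piece_boundary`) satisfies, for `γ_H` near `1` non-Levi `G`-regular, with `u_H :=` the Cayley∕Möbius shift of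
`γ_H` (one step less deep, same torus, `u_H ∈ V′` as near as wanted — N5b): the two `S`-rows (★ p846474) and the transport
`Σ_c Δ‴(γ_H,c)Φ(c, g_int) = q⁻²·Σ_c Δ‴(u_H,c)Φ(c, g′)` (★ (A3) p846531 with `hF` = N3); types (1)∕(2) by a case split on a root; the shift is the HERMITIAN `φ_θ` (module docstring).
[cite: Rogawski1990, §4.9 Prop. 4.9.1 p. 55; §4.3 p. 43] [cite: Kottwitz1986, §3] [cite: Laumon1995, Lemma (5.3.2) p. 136] -/
theorem liftInterior_of_levelTwo_of_isUnramifiedIn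
    (L : Type) [Field L] [NumberField L] [IsCMField L] (H' : Matrix (Fin 3) (Fin 3) L) (μ : HeckeCharacter L)
    {v : HeightOneSpectrum (𝓞 ↥(maximalRealSubfield L))}
    (hH' : (H'.map (cmConjRingHom L)).transpose = H') (w : PlacesOver L v)
    (hw : IsCMField.complexConj L • w.1 = w.1) (hv : Algebra.IsUnramifiedIn (𝓞 L) v.asIdeal)
    (hH'w : IsUnit (placeForm H' w.1)) (hH'i : hH'w.unit ∈ glInt 3 (w.1.adicCompletion L))
    (hμ : μ.IsUnramifiedAt w.1) (hμu : μ.IsUnitary)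
    (hμω : ∀ x : ideleGroup ↥(maximalRealSubfield L), μ (AdeleRing.ideleBaseChange ↥(maximalRealSubfield L) L x) = quadraticHeckeCharCM L x)
    [MeasurableSpace ((cmDatum L 3 H').Local v)] [BorelSpace ((cmDatum L 3 H').Local v)]
    [∀ γ : ((cmDatum L 3 H').Local v), MeasurableSpace (((cmDatum L 3 H').Local v) ⧸ Subgroup.centralizer ({γ} : Set ((cmDatum L 3 H').Local v)))]
    [∀ γ : ((cmDatum L 3 H').Local v), BorelSpace (((cmDatum L 3 H').Local v) ⧸ Subgroup.centralizer ({γ} : Set ((cmDatum L 3 H').Local v)))]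
    [MeasurableSpace ((cmDatum L 2 (Matrix.of fun i j : Fin 2 => if i.val + j.val + 1 = 2 then (1 : L) else 0)).Local v × (cmDatum L 1 (Matrix.of fun i j : Fin 1 => if i.val + j.val + 1 = 1 then (1 : L) else 0)).Local v)] [BorelSpace ((cmDatum L 2 (Matrix.of fun i j : Fin 2 => if i.val + j.val + 1 = 2 then (1 : L) else 0)).Local v × (cmDatum L 1 (Matrix.of fun i j : Fin 1 => if i.val + j.val + 1 = 1 then (1 : L) else 0)).Local v)]
  [∀ a : (cmDatum L 2 (Matrix.of fun i j : Fin 2 => if i.val + j.val + 1 = 2 then (1 : L) else 0)).Local v × (cmDatum L 1 (Matrix.of fun i j : Fin 1 => if i.val + j.val + 1 = 1 then (1 : L) else 0)).Local v, MeasurableSpace (((cmDatum L 2 (Matrix.of fun i j : Fin 2 => if i.val + j.val + 1 = 2 then (1 : L) else 0)).Local v × (cmDatum L 1 (Matrix.of fun i j : Fin 1 => if i.val + j.val + 1 = 1 then (1 : L) else 0)).Local v) ⧸ Subgroup.centralizer ({a} : Set ((cmDatum L 2 (Matrix.of fun i j : Fin 2 => if i.val + j.val + 1 = 2 then (1 :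 L) else 0)).Local v × (cmDatum L 1 (Matrix.of fun i j : Fin 1 => if i.val + j.val + 1 = 1 then (1 : L) else 0)).Local v)))]
  [∀ a : (cmDatum L 2 (Matrix.of fun i j : Fin 2 => if i.val + j.val + 1 = 2 then (1 : L) else 0)).Local v × (cmDatum L 1 (Matrix.of fun i j : Fin 1 => if i.val + j.val + 1 = 1 then (1 : L) else 0)).Local v, BorelSpace (((cmDatum L 2 (Matrix.of fun i j : Fin 2 => if i.val + j.val + 1 = 2 then (1 : L) else 0)).Local v × (cmDatum L 1 (Matrix.of fun i j : Fin 1 => if i.val + j.val + 1 = 1 then (1 : L) else 0)).Local v) ⧸ Subgroup.centralizer ({a} : Set ((cmDatum L 2 (Matrix.of fun i j : Fin 2 => if i.val + j.val + 1 = 2 then (1 : L) else 0)).Local v × (cmDatum L 1 (Matrix.of fun i j : Fin 1 => if i.val + j.val + 1 = 1 then (1 : L) else 0)).Local v)))]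
    (νH : Measure ((cmDatum L 2 (Matrix.of fun i j : Fin 2 => if i.val + j.val + 1 = 2 then (1 : L) else 0)).Local v × (cmDatum L 1 (Matrix.of fun i j : Fin 1 => if i.val + j.val + 1 = 1 then (1 : L) else 0)).Local v)) [νH.IsHaarMeasure] [νH.IsMulRightInvariant]
    (νG : Measure ((cmDatum L 3 H').Local v)) [νG.IsHaarMeasure] [νG.IsMulRightInvariant]
    {mH : OrbitalMeasureFamily ((cmDatum L 2 (Matrix.of fun i j : Fin 2 => if i.val + j.val + 1 = 2 then (1 : L) else 0)).Local v × (cmDatum L 1 (Matrix.of fun i j : Fin 1 => if i.val + j.val + 1 = 1 then (1 : L) else 0)).Local v)} {mG : OrbitalMeasureFamily ((cmDatum L 3 H').Local v)}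
    (hmH : mH.IsCanonical (IsLocalGRegular L v) νH)
    (hmG : mG.IsCanonical (fun γ => IsRegularElt (γ.val : GL (Fin 3) (UnitaryGroup.LocalRing L v))) νG)
    (g : ((cmDatum L 3 H').Local v) → ℂ) (hg : IsLocSmooth g) (hgK : tsupport g ⊆ (cmLocalIntegralLevel L 3 H' v : Set ((cmDatum L 3 H').Local v)))
    (hginv : ∀ u ∈ cmLocalIntegralLevel L 3 H' v, ∀ x, g (u * x * u⁻¹) = g x)
    (hg2 : ∀ u : (cmDatum L 3 H').Local v,
      (∀ a b, Valued.v (((toPlace v w (HeckeCharacter.uniformizer ↥(maximalRealSubfield L) v : v.adicCompletion ↥(maximalRealSubfield L))) ^ 2)⁻¹ *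
        ((((localNonsplitEquiv (IsCMField.complexConj L) H' (IsCMField.complexConj_ne_one L) w hw u :
            ↥(unitaryGroupOfForm (galAdicCompletionMap (L := L) (IsCMField.complexConj L) hw) (placeForm H' w.1))) : GL (Fin 3) (w.1.adicCompletion L)) :
              Matrix (Fin 3) (Fin 3) (w.1.adicCompletion L)) a b - (1 : Matrix (Fin 3) (Fin 3) (w.1.adicCompletion L)) a b)) ≤ 1) →
      ∀ x, g (u * x) = g x)
    (c' : ℕ → ℂ) (hc' : ((∀ x : ((cmDatum L 3 H').Local v), (x ∈ cmLocalIntegralLevel L 3 H' v ∧ (∀ a b, Valued.v (((toPlace v w (HeckeCharacter.uniformizer ↥(maximalRealSubfield L) v : v.adicCompletion ↥(maximalRealSubfield L))) ^ 1)⁻¹ *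
        ((((localNonsplitEquiv (IsCMField.complexConj L) H' (IsCMField.complexConj_ne_one L) w hw (x) :
            ↥(unitaryGroupOfForm (galAdicCompletionMap (L := L) (IsCMField.complexConj L) hw) (placeForm H' w.1))) : GL (Fin 3) (w.1.adicCompletion L)) :
              Matrix (Fin 3) (Fin 3) (w.1.adicCompletion L)) a b - (1 : Matrix (Fin 3) (Fin 3) (w.1.adicCompletion L)) a b)) ≤ 1) ∧
        (redMat ((toPlace v w (HeckeCharacter.uniformizer ↥(maximalRealSubfield L) v : v.adicCompletion ↥(maximalRealSubfield L)))⁻¹ • ((((x).val : GL (Fin 3) (UnitaryGroup.LocalRing L v)).val.map (Pi.evalRingHom (fun w' : PlacesOver L v => w'.1.adicCompletion L) w)) - 1))) ^ 3 = 0 ∧ (redMat ((toPlace v w (HeckeCharacter.uniformizer ↥(maximalRealSubfield L) v : v.adicCompletion ↥(maximalRealSubfield L)))⁻¹ • ((((x).val : GL (Fin 3) (UnitaryGroup.LocalRing L v)).val.map (Pi.evalRingHom (fun w' : PlacesOver L v => w'.1.adicCompletion L) w)) - 1))).rank = 0) → g x = c' 0) ∧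
      (∀ x : ((cmDatum L 3 H').Local v), (x ∈ cmLocalIntegralLevel L 3 H' v ∧ (∀ a b, Valued.v (((toPlace v w (HeckeCharacter.uniformizer ↥(maximalRealSubfield L) v : v.adicCompletion ↥(maximalRealSubfield L))) ^ 1)⁻¹ *
        ((((localNonsplitEquiv (IsCMField.complexConj L) H' (IsCMField.complexConj_ne_one L) w hw (x) :
            ↥(unitaryGroupOfForm (galAdicCompletionMap (L := L) (IsCMField.complexConj L) hw) (placeForm H' w.1))) : GL (Fin 3) (w.1.adicCompletion L)) :
              Matrix (Fin 3) (Fin 3) (w.1.adicCompletion L)) a b - (1 : Matrix (Fin 3) (Fin 3) (w.1.adicCompletion L)) a b)) ≤ 1) ∧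
        (redMat ((toPlace v w (HeckeCharacter.uniformizer ↥(maximalRealSubfield L) v : v.adicCompletion ↥(maximalRealSubfield L)))⁻¹ • ((((x).val : GL (Fin 3) (UnitaryGroup.LocalRing L v)).val.map (Pi.evalRingHom (fun w' : PlacesOver L v => w'.1.adicCompletion L) w)) - 1))) ^ 3 = 0 ∧ (redMat ((toPlace v w (HeckeCharacter.uniformizer ↥(maximalRealSubfield L) v : v.adicCompletion ↥(maximalRealSubfield L)))⁻¹ • ((((x).val : GL (Fin 3) (UnitaryGroup.LocalRing L v)).val.map (Pi.evalRingHom (fun w' : PlacesOver L v => w'.1.adicCompletion L) w)) - 1))).rank = 1) → g x = c' 1) ∧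
      (∀ x : ((cmDatum L 3 H').Local v), (x ∈ cmLocalIntegralLevel L 3 H' v ∧ (∀ a b, Valued.v (((toPlace v w (HeckeCharacter.uniformizer ↥(maximalRealSubfield L) v : v.adicCompletion ↥(maximalRealSubfield L))) ^ 1)⁻¹ *
        ((((localNonsplitEquiv (IsCMField.complexConj L) H' (IsCMField.complexConj_ne_one L) w hw (x) :
            ↥(unitaryGroupOfForm (galAdicCompletionMap (L := L) (IsCMField.complexConj L) hw) (placeForm H' w.1))) : GL (Fin 3) (w.1.adicCompletion L)) :
              Matrix (Fin 3) (Fin 3) (w.1.adicCompletion L)) a b - (1 : Matrix (Fin 3) (Fin 3) (w.1.adicCompletion L)) a b)) ≤ 1) ∧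
        (redMat ((toPlace v w (HeckeCharacter.uniformizer ↥(maximalRealSubfield L) v : v.adicCompletion ↥(maximalRealSubfield L)))⁻¹ • ((((x).val : GL (Fin 3) (UnitaryGroup.LocalRing L v)).val.map (Pi.evalRingHom (fun w' : PlacesOver L v => w'.1.adicCompletion L) w)) - 1))) ^ 3 = 0 ∧ (redMat ((toPlace v w (HeckeCharacter.uniformizer ↥(maximalRealSubfield L) v : v.adicCompletion ↥(maximalRealSubfield L)))⁻¹ • ((((x).val : GL (Fin 3) (UnitaryGroup.LocalRing L v)).val.map (Pi.evalRingHom (fun w' : PlacesOver L v => w'.1.adicCompletion L) w)) - 1))).rank = 2) → g x = c' 2))) :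
    ∃ g' : ((cmDatum L 3 H').Local v) → ℂ, IsLocSmooth g' ∧ tsupport g' ⊆ (cmLocalIntegralLevel L 3 H' v : Set ((cmDatum L 3 H').Local v)) ∧
      (∀ u ∈ cmLocalIntegralLevel L 3 H' v, ∀ x, g' (u * x * u⁻¹) = g' x) ∧
      (∀ k ∈ cmLocalIntegralLevel L 3 H' v,
        (redMat (((k).val : GL (Fin 3) (UnitaryGroup.LocalRing L v)).val.map (Pi.evalRingHom (fun w' : PlacesOver L v => w'.1.adicCompletion L) w)) - 1) ^ 3 = 0 →
        g' k = c' (redMat (((k).val : GL (Fin 3) (UnitaryGroup.LocalRing L v)).val.map (Pi.evalRingHom (fun w' : PlacesOver L v => w'.1.adicCompletion L) w)) - 1).rank) ∧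
      ∀ V' ∈ 𝓝 (1 : ((cmDatum L 2 (Matrix.of fun i j : Fin 2 => if i.val + j.val + 1 = 2 then (1 : L) else 0)).Local v × (cmDatum L 1 (Matrix.of fun i j : Fin 1 => if i.val + j.val + 1 = 1 then (1 : L) else 0)).Local v)), ∃ V ∈ 𝓝 (1 : ((cmDatum L 2 (Matrix.of fun i j : Fin 2 => if i.val + j.val + 1 = 2 then (1 : L) else 0)).Local v × (cmDatum L 1 (Matrix.of fun i j : Fin 1 => if i.val + j.val + 1 = 1 then (1 : L) else 0)).Local v)), ∀ γH ∈ V, IsLocalGRegular L v γH →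
        ¬ (∃ (y : ((cmDatum L 2 (Matrix.of fun i j : Fin 2 => if i.val + j.val + 1 = 2 then (1 : L) else 0)).Local v × (cmDatum L 1 (Matrix.of fun i j : Fin 1 => if i.val + j.val + 1 = 1 then (1 : L) else 0)).Local v)) (d' : Fin 2 → (UnitaryGroup.LocalRing L v)ˣ),
          glDiagonal 2 (UnitaryGroup.LocalRing L v) d' = ((y * γH * y⁻¹).1.val : GL (Fin 2) (UnitaryGroup.LocalRing L v))) →
        ∃ uH ∈ V', IsLocalGRegular L v uH ∧
          stableOrbitalIntegralRel (IsLocalStablyConjH L v) mH (((((cmLocalIntegralLevel L 2 (Matrix.of fun i j : Fin 2 => if i.val + j.val + 1 = 2 then (1 : L) else 0) v).prod (cmLocalIntegralLevel L 1 (Matrix.of fun i j : Fin 1 => if i.val + j.val + 1 = 1 then (1 : L) else 0) v)) : Subgroup ((cmDatum L 2 (Matrix.of fun i j : Fin 2 => if i.val + j.val + 1 = 2 then (1 : L) else 0)).Local v × (cmDatum L 1 (Matrix.of fun i j : Fin 1 => if i.val + j.val + 1 = 1 then (1 : L) else 0)).Local v)) : Set ((cmDatum L 2 (Matrix.of fun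 i j : Fin 2 => if i.val + j.val + 1 = 2 then (1 : L) else 0)).Local v × (cmDatum L 1 (Matrix.of fun i j : Fin 1 => if i.val + j.val + 1 = 1 then (1 : L) else 0)).Local v)).indicator fun h => if (redMat (((h).1.val : GL (Fin 2) (UnitaryGroup.LocalRing L v)).val.map (Pi.evalRingHom (fun w' : PlacesOver L v => w'.1.adicCompletion L) w)) - 1) ^ 2 = 0 ∧ (redMat (((h).1.val : GL (Fin 2) (UnitaryGroup.LocalRing L v)).val.map (Pi.evalRingHom (fun w' : PlacesOver L v => w'.1.adicCompletion L) w)) - 1).rank = 0 then (1 : ℂ) else 0) uH =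
            stableOrbitalIntegralRel (IsLocalStablyConjH L v) mH (((((cmLocalIntegralLevel L 2 (Matrix.of fun i j : Fin 2 => if i.val + j.val + 1 = 2 then (1 : L) else 0) v).prod (cmLocalIntegralLevel L 1 (Matrix.of fun i j : Fin 1 => if i.val + j.val + 1 = 1 then (1 : L) else 0) v)) : Subgroup ((cmDatum L 2 (Matrix.of fun i j : Fin 2 => if i.val + j.val + 1 = 2 then (1 : L) else 0)).Local v × (cmDatum L 1 (Matrix.of fun i j : Fin 1 => if i.val + j.val + 1 = 1 then (1 : L) else 0)).Local v)) : Set ((cmDatum L 2 (Matrix.of fun i j : Fin 2 => if i.val + j.val + 1 = 2 then (1 : L) else 0)).Local v × (cmDatum L 1 (Matrix.of fun i j : Fin 1 => if i.val + j.val + 1 = 1 then (1 : L) else 0)).Local v)).indicator fun h => if (redMat (((h).1.val : GL (Fin 2) (UnitaryGroup.LocalRing L v)).val.map (Pi.evalRingHom (fun w' : PlacesOver L v => w'.1.adicCompletion L) w)) - 1) ^ 2 = 0 ∧ (redMat (((h).1.val : GL (Fin 2) (UnitaryGroup.LocalRing L v)).val.map (Pi.evalRingHom (fun w' : PlacesOver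 L v => w'.1.adicCompletion L) w)) - 1).rank = 0 then (1 : ℂ) else 0) γH -
              ((Ideal.absNorm v.asIdeal : ℕ) : ℂ)⁻¹ * stableOrbitalIntegralRel (IsLocalStablyConjH L v) mH (((((cmLocalIntegralLevel L 2 (Matrix.of fun i j : Fin 2 => if i.val + j.val + 1 = 2 then (1 : L) else 0) v).prod (cmLocalIntegralLevel L 1 (Matrix.of fun i j : Fin 1 => if i.val + j.val + 1 = 1 then (1 : L) else 0) v)) : Subgroup ((cmDatum L 2 (Matrix.of fun i j : Fin 2 => if i.val + j.val + 1 = 2 then (1 : L) else 0)).Local v × (cmDatum L 1 (Matrix.of fun i j : Fin 1 => if i.val + j.val + 1 = 1 then (1 : L) else 0)).Local v)) : Set ((cmDatum L 2 (Matrix.of fun i j : Fin 2 => if i.val + j.val + 1 = 2 then (1 : L) else 0)).Local v × (cmDatum L 1 (Matrix.of fun i j : Fin 1 => if i.val + j.val + 1 = 1 then (1 : L) else 0)).Local v)).indicator fun h => if (redMat (((h).1.val : GL (Fin 2) (UnitaryGroup.LocalRing L v)).val.map (Pi.evalRingHom (fun w' : PlacesOver L v => w'.1.adicCompletion L) w))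 - 1) ^ 2 = 0 ∧ (redMat (((h).1.val : GL (Fin 2) (UnitaryGroup.LocalRing L v)).val.map (Pi.evalRingHom (fun w' : PlacesOver L v => w'.1.adicCompletion L) w)) - 1).rank = 1 then (1 : ℂ) else 0) γH ∧
          stableOrbitalIntegralRel (IsLocalStablyConjH L v) mH (((((cmLocalIntegralLevel L 2 (Matrix.of fun i j : Fin 2 => if i.val + j.val + 1 = 2 then (1 : L) else 0) v).prod (cmLocalIntegralLevel L 1 (Matrix.of fun i j : Fin 1 => if i.val + j.val + 1 = 1 then (1 : L) else 0) v)) : Subgroup ((cmDatum L 2 (Matrix.of fun i j : Fin 2 => if i.val + j.val + 1 = 2 then (1 : L) else 0)).Local v × (cmDatum L 1 (Matrix.of fun i j : Fin 1 => if i.val + j.val + 1 = 1 then (1 : L) else 0)).Local v)) : Set ((cmDatum L 2 (Matrix.of fun i j : Fin 2 => if i.val + j.val + 1 = 2 then (1 : L) else 0)).Local v × (cmDatum L 1 (Matrix.of fun i j : Fin 1 => if i.val + j.val + 1 = 1 then (1 : L) else 0)).Local v)).indicator fun h => if (redMat (((h).1.val : GL (Fin 2) (UnitaryGroup.LocalRing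 L v)).val.map (Pi.evalRingHom (fun w' : PlacesOver L v => w'.1.adicCompletion L) w)) - 1) ^ 2 = 0 ∧ (redMat (((h).1.val : GL (Fin 2) (UnitaryGroup.LocalRing L v)).val.map (Pi.evalRingHom (fun w' : PlacesOver L v => w'.1.adicCompletion L) w)) - 1).rank = 1 then (1 : ℂ) else 0) uH =
            ((Ideal.absNorm v.asIdeal : ℕ) : ℂ)⁻¹ * stableOrbitalIntegralRel (IsLocalStablyConjH L v) mH (((((cmLocalIntegralLevel L 2 (Matrix.of fun i j : Fin 2 => if i.val + j.val + 1 = 2 then (1 : L) else 0) v).prod (cmLocalIntegralLevel L 1 (Matrix.of fun i j : Fin 1 => if i.val + j.val + 1 = 1 then (1 : L) else 0) v)) : Subgroup ((cmDatum L 2 (Matrix.of fun i j : Fin 2 => if i.val + j.val + 1 = 2 then (1 : L) else 0)).Local v × (cmDatum L 1 (Matrix.of fun i j : Fin 1 => if i.val + j.val + 1 = 1 then (1 : L) else 0)).Local v)) : Set ((cmDatum L 2 (Matrix.of fun i j : Fin 2 => if i.val + j.val + 1 = 2 then (1 : L) else 0)).Local v × (cmDatum L 1 (Matrix.of fun i j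 : Fin 1 => if i.val + j.val + 1 = 1 then (1 : L) else 0)).Local v)).indicator fun h => if (redMat (((h).1.val : GL (Fin 2) (UnitaryGroup.LocalRing L v)).val.map (Pi.evalRingHom (fun w' : PlacesOver L v => w'.1.adicCompletion L) w)) - 1) ^ 2 = 0 ∧ (redMat (((h).1.val : GL (Fin 2) (UnitaryGroup.LocalRing L v)).val.map (Pi.evalRingHom (fun w' : PlacesOver L v => w'.1.adicCompletion L) w)) - 1).rank = 1 then (1 : ℂ) else 0) γH ∧
          (∑ᶠ cG : ConjClasses ((cmDatum L 3 H').Local v),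
            ((finExplicitCollection L H' μ (finExplicitDelta_conj_left_all L H' μ) (finExplicitDelta_conj_right_all L H' μ)) v).Δ γH (Quotient.out cG) *
              classOrbitalIntegral mG ({x : (cmDatum L 3 H').Local v | (∀ a b, Valued.v (((toPlace v w (HeckeCharacter.uniformizer ↥(maximalRealSubfield L) v : v.adicCompletion ↥(maximalRealSubfield L))) ^ 1)⁻¹ *
        ((((localNonsplitEquiv (IsCMField.complexConj L) H' (IsCMField.complexConj_ne_one L) w hw (x) :
            ↥(unitaryGroupOfForm (galAdicCompletionMap (L := L) (IsCMField.complexConj L) hw) (placeForm H' w.1))) : GL (Fin 3) (w.1.adicCompletion L)) :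
              Matrix (Fin 3) (Fin 3) (w.1.adicCompletion L)) a b - (1 : Matrix (Fin 3) (Fin 3) (w.1.adicCompletion L)) a b)) ≤ 1)}.indicator g) cG) =
            (((Ideal.absNorm v.asIdeal : ℕ) : ℂ) ^ 2)⁻¹ *
            (∑ᶠ cG : ConjClasses ((cmDatum L 3 H').Local v),
            ((finExplicitCollection L H' μ (finExplicitDelta_conj_left_all L H' μ) (finExplicitDelta_conj_right_all L H' μ)) v).Δ uH (Quotient.out cG) *
              classOrbitalIntegral mG g' cG) := by
  have _hH'i := hH'i  -- binders of the socket text (END fold VERBATIM) not needed by the proof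
  have _hμu := hμu
  have _hg2 := hg2
  -- ───── constants of the place ─────
  have hsub : Subsingleton (PlacesOver L v) :=
    PlacesOver.subsingleton_of_smul_eq (IsCMField.complexConj L) (IsCMField.complexConj_ne_one L) w hw
  haveI := Literature.NumberTheory.Automorphic.isAdicComplete_maximalIdeal_valuedInteger_adicCompletion L w.1
  have hiso := ValuativeRel.isEquiv (ValuativeRel.valuation (w.1.adicCompletion L))
    (Valued.v : Valuation (w.1.adicCompletion L) (WithZero (Multiplicative ℤ)))
  have hH'u : IsUnit H' := by
    rw [Matrix.isUnit_iff_isUnit_det]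
    have h := (Matrix.isUnit_iff_isUnit_det _).1 hH'w
    rw [show placeForm H' w.1 = (algebraMap L (w.1.adicCompletion L)).mapMatrix H' from rfl, ← RingHom.map_det] at h
    exact isUnit_iff_ne_zero.2 fun h0 => h.ne_zero (by rw [h0, map_zero])
  have hdetH : H'.det ≠ 0 := fun h0 => by
    rw [Matrix.isUnit_iff_isUnit_det, h0] at hH'u; exact not_isUnit_zero hH'u
  -- the shift parameter `c = ι_v(ϖ_v)`
  obtain ⟨c, hcdef⟩ : ∃ c : LocalRing L v, c = (((isUnit_toLocalRing_uniformizer L v).unit : (LocalRing L v)ˣ) : LocalRing L v) := ⟨_, rfl⟩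
  have hσc : conjLocal L (IsCMField.complexConj L) v c = c := by rw [hcdef]; exact conjLocal_toLocalRing_uniformizer L v
  have hc : Valued.v (c w) = WithZero.exp (-1 : ℤ) := by rw [hcdef]; exact valued_toLocalRing_uniformizer_apply L v w hv
  have hcw : c w = toPlace v w (HeckeCharacter.uniformizer ↥(maximalRealSubfield L) v : v.adicCompletion ↥(maximalRealSubfield L)) := by
    rw [hcdef, IsUnit.unit_spec, toLocalRing_apply]
  have hc0 : c w ≠ 0 := fun h0 => by rw [h0, map_zero] at hc; exact WithZero.zero_ne_coe hc
  have hcc0 : c w ^ 2 ≠ 0 := pow_ne_zero _ hc0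
  have hcc : Valued.v (c w ^ 2) = WithZero.exp (-2 : ℤ) := by
    rw [map_pow, hc, ← WithZero.exp_nsmul]; norm_num
  have hc1 : Valued.v (c w) < 1 := by rw [hc, ← WithZero.exp_zero]; exact WithZero.exp_lt_exp.2 (by norm_num)
  -- ───── the shear constant `θ`: `θ + σθ = 1`, `|θ_w| ≤ 1` (★ L1, any residue characteristic) ─────
  obtain ⟨θ, hθ', hθv⟩ := exists_conjLocal_add_self_eq_one L v w hw hv
  have hθ : θ + conjLocal L (IsCMField.complexConj L) v θ = 1 := by rw [add_comm]; exact hθ'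
  haveI : Algebra.IsQuadraticExtension ↥(maximalRealSubfield L) L := IsCMField.isQuadraticExtension L
  set σw := galAdicCompletionMap (L := L) (IsCMField.complexConj L) hw with hσw
  have hσθw : (conjLocal L (IsCMField.complexConj L) v θ) w = σw (θ w) := conjLocal_apply_eq_of_smul_eq (IsCMField.complexConj L) (IsCMField.complexConj_ne_one L) v w hw θ
  have hθw : θ w + σw (θ w) = 1 := by
    have h := congrArg (fun f : LocalRing L v => f w) hθ
    simpa only [Pi.add_apply, Pi.one_apply, hσθw] using h
  have hθ'v : Valued.v ((conjLocal L (IsCMField.complexConj L) v θ) w) ≤ 1 := by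
    rw [show (conjLocal L (IsCMField.complexConj L) v θ) w = 1 - θ w by rw [hσθw]; linear_combination hθw]
    exact (Valuation.map_sub _ _ _).trans (max_le (by rw [map_one]) hθv)
  -- the key scalar `Δ = θσθ − (c−θ)(c−σθ) = c(1−c)` is a unit of `E_v` (★'s `4c = (c+1)² − (c−1)²`)
  have hΔ : IsUnit (θ * conjLocal L (IsCMField.complexConj L) v θ - (c - θ) * (c - conjLocal L (IsCMField.complexConj L) v θ)) := by
    have e : θ * conjLocal L (IsCMField.complexConj L) v θ - (c - θ) * (c - conjLocal L (IsCMField.complexConj L) v θ) = c * (1 - c) := by linear_combination c * hθ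
    rw [e]
    refine (hcdef ▸ Units.isUnit _).mul (isUnit_localRing_of_ne_zero_of_subsingleton L v hsub fun h0 => ?_)
    have h1 := congrFun h0 w
    simp only [Pi.sub_apply, Pi.one_apply, Pi.zero_apply] at h1
    have : Valued.v (c w) = 1 := by rw [← sub_eq_zero.1 h1, map_one]
    rw [this] at hc1; exact lt_irrefl _ hc1
  have hem1 : WithZero.exp (-2 : ℤ) ≤ WithZero.exp (-1 : ℤ) := WithZero.exp_le_exp.2 (by norm_num)
  have he1 : WithZero.exp (-1 : ℤ) < 1 := by rw [← WithZero.exp_zero, WithZero.exp_lt_exp]; norm_num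
  have he2 : WithZero.exp (-2 : ℤ) < 1 := lt_of_le_of_lt hem1 he1
  -- ───── the piece `g′` (★ p846532) ─────
  have Hob1 := exists_levelOne_piece_boundary L H' w hw hv c'
  obtain ⟨g', hg's, hg'K, hg'inv, -, hg'c⟩ := Hob1
  refine ⟨g', hg's, hg'K, hg'inv, hg'c, ?_⟩
  intro V' hV'
  -- ───── N5b: the shift lands in `V′` ─────
  have Hob2 := exists_level_forall_hermitianShift_mem_of_mem_nhds_one L w hw hc hθ hθv hV'
  obtain ⟨j, hj, H5⟩ := Hob2
  -- ───── the neighbourhood `V` ─────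
  have Hob3 := exists_nhds_one_twoDeep_endoEmbLocal L v w
  obtain ⟨Vι, hVι, Hι⟩ := Hob3
  refine ⟨_ ∩ (_ ∩ (_ ∩ Vι)), Filter.inter_mem (setOf_entrywise_deep_mem_nhds_one L v w (pow_ne_zero (j + 1) hc0))
    (Filter.inter_mem (setOf_entrywise_deep_mem_nhds_one L v w hcc0)
    (Filter.inter_mem (setOf_residuallyUnipotent_endoEmbLocal_mem_nhds_one L v w) hVι)), ?_⟩
  rintro γH ⟨hγ5, hγ2, hγ0, hγι⟩ hreg hnl
  simp only [Set.mem_setOf_eq] at hγ5 hγ2 hγ0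
  obtain ⟨hgj, huj⟩ := hγ5
  have hgj' : ∀ i k, Valued.v (((((γH.1.val : GL (Fin 2) (LocalRing L v)).val : Matrix (Fin 2) (Fin 2) (LocalRing L v))).map
      (Pi.evalRingHom (fun w' : UnitaryGroup.PlacesOver L v => w'.1.adicCompletion L) w) - 1) i k) ≤ Valued.v (c w) ^ (j + 1) := fun i k => by
    rw [← map_pow]; exact hgj i k
  have huj' : Valued.v (finGammaTwo L v γH w - 1) ≤ Valued.v (c w) ^ (j + 1) := by rw [← map_pow]; exact huj
  have Hob4 := hγ2
  obtain ⟨hg2w, hu2w⟩ := Hob4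
  have hdeepι := Hι γH hγι
  -- level-1 and level-2 bounds in the three currencies
  have hg2c : ∀ i j, Valued.v (((((γH.1.val : GL (Fin 2) (LocalRing L v)).val.map (Pi.evalRingHom (fun w' : PlacesOver L v => w'.1.adicCompletion L) w))) - 1) i j) ≤ Valued.v (c w) ^ (1 + 1) := fun i j => by
    rw [← map_pow]; exact hg2w i j
  have hu2c : Valued.v (finGammaTwo L v γH w - 1) ≤ Valued.v (c w) ^ (1 + 1) := by rw [← map_pow]; exact hu2w
  have hg2c' : ∀ i j, Valued.v (((((γH.1.val : GL (Fin 2) (LocalRing L v)).val.map (Pi.evalRingHom (fun w' : PlacesOver L v => w'.1.adicCompletion L) w))) - 1) i j) ≤ Valued.v (c w) ^ 2 := hg2c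
  have hu2c' : Valued.v (finGammaTwo L v γH w - 1) ≤ Valued.v (c w) ^ 2 := hu2c
  have hg1 : ∀ i j, Valued.v (((((γH.1.val : GL (Fin 2) (LocalRing L v)).val.map (Pi.evalRingHom (fun w' : PlacesOver L v => w'.1.adicCompletion L) w))) - 1) i j) ≤ Valued.v (c w) := fun i j =>
    (hg2w i j).trans (by rw [hcc, hc]; exact hem1)
  have hu1 : Valued.v (finGammaTwo L v γH w - 1) ≤ Valued.v (c w) := hu2w.trans (by rw [hcc, hc]; exact hem1)
  have hg1e : ∀ i j, Valued.v (((((γH.1.val : GL (Fin 2) (LocalRing L v)).val.map (Pi.evalRingHom (fun w' : PlacesOver L v => w'.1.adicCompletion L) w))) - 1) i j) ≤ WithZero.exp (-1 : ℤ) := fun i j => by rw [← hc]; exact hg1 i j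
  have hu1e : Valued.v (finGammaTwo L v γH w - 1) ≤ WithZero.exp (-1 : ℤ) := by rw [← hc]; exact hu1
  have hdeepN3 : ∀ i j, Valued.v (((((endoEmbLocal L v γH).val : GL (Fin 3) (LocalRing L v)).val.map
      (Pi.evalRingHom (fun w' : UnitaryGroup.PlacesOver L v => w'.1.adicCompletion L) w)) - 1) i j) ≤ Valued.v (c w) ^ 2 := fun i j => by
    rw [← map_pow, hcc]; exact hdeepι i j
  -- integrality of `charpoly(ι_v γ_H)_w` in both currencies
  have hintV : ∀ i : ℕ, ((((endoEmbLocal L v γH).val : GL (Fin 3) (UnitaryGroup.LocalRing L v)).val.map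
      (Pi.evalRingHom (fun w' : PlacesOver L v => w'.1.adicCompletion L) w)).charpoly.coeff i) ∈ Valued.integer (w.1.adicCompletion L) :=
    fun i => (Valuation.mem_integer_iff _ _).2 (v_charpoly_coeff_le_one_of_residuallyUnipotent _ hγ0 i)
  have hint : ∀ i : ℕ, ((((endoEmbLocal L v γH).val : GL (Fin 3) (LocalRing L v)).val.map
      (Pi.evalRingHom (fun w' : PlacesOver L v => w'.1.adicCompletion L) w)).charpoly.coeff i) ∈ 𝒪[w.1.adicCompletion L] :=
    fun i => (Valuation.mem_integer_iff _ _).2 ((hiso.le_one_iff_le_one).2 ((Valuation.mem_integer_iff _ _).1 (hintV i)))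
  -- the 3 × 3 numerator determinant of the shift is a unit as soon as the blocks' are
  have hN3_of :
      IsUnit (((θ • ((γH.1.val : GL (Fin 2) (LocalRing L v)).val : Matrix (Fin 2) (Fin 2) (LocalRing L v)) + (c - θ) • (1 : Matrix (Fin 2) (Fin 2) (LocalRing L v))).det)) →
      IsUnit (((θ • ((γH.2.val : GL (Fin 1) (LocalRing L v)).val : Matrix (Fin 1) (Fin 1) (LocalRing L v)) + (c - θ) • (1 : Matrix (Fin 1) (Fin 1) (LocalRing L v))).det)) →
      IsUnit (θ • (((endoEmbLocal L v γH).val : GL (Fin 3) (LocalRing L v)).val : Matrix (Fin 3) (Fin 3) (LocalRing L v)) +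
        (c - θ) • (1 : Matrix (Fin 3) (Fin 3) (LocalRing L v))).det := fun hU2p hU1p' => by
    rw [coe_endoEmbLocal, coe_endoGL, smul_reindex_add_smul_one, smul_fromBlocks_add_smul_one, Matrix.det_reindex_self,
      Matrix.det_fromBlocks_zero₁₂]
    exact hU2p.mul hU1p'
  -- `χ(u)` read on the one-place model
  have hev : ∀ (γ : ((cmDatum L 2 (Matrix.of fun i j : Fin 2 => if i.val + j.val + 1 = 2 then (1 : L) else 0)).Local v × (cmDatum L 1 (Matrix.of fun i j : Fin 1 => if i.val + j.val + 1 = 1 then (1 : L) else 0)).Local v)),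
      ((finCharpolyTwo L v γ).eval (finGammaTwo L v γ)) w =
        ((γ.1.val : GL (Fin 2) (LocalRing L v)).val.map (Pi.evalRingHom (fun w' : PlacesOver L v => w'.1.adicCompletion L) w)).charpoly.eval (finGammaTwo L v γ w) := fun γ => by
    have e : ((finCharpolyTwo L v γ).eval (finGammaTwo L v γ)) w = (Pi.evalRingHom (fun w' : PlacesOver L v => w'.1.adicCompletion L) w) ((finCharpolyTwo L v γ).eval (finGammaTwo L v γ)) := rfl
    rw [e, ← Polynomial.eval₂_at_apply, ← Polynomial.eval_map, finCharpolyTwo, ← Matrix.charpoly_map]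
    rfl
  by_cases hroot : ∃ x : w.1.adicCompletion L, (((γH.1.val : GL (Fin 2) (UnitaryGroup.LocalRing L v)).val.map
      (Pi.evalRingHom (fun w' : PlacesOver L v => w'.1.adicCompletion L) w)).charpoly).IsRoot x
  · /- ───── TYPE (1): `χ_{g_w}` splits over `L_w` ───── -/
    have Hob5 := exists_flicker_exponents_split L v w hw hreg hintV hroot
    obtain ⟨α, γ, N₁, N₂, N, hα, hγ, hαγ, hN₁, hN₂, hN, -⟩ := Hob5
    have hcm : (((γH.1.val : GL (Fin 2) (LocalRing L v)).val.map (Pi.evalRingHom (fun w' : PlacesOver L v => w'.1.adicCompletion L) w))).charpoly = ((((γH.1.val : GL (Fin 2) (LocalRing L v)) : Matrix (Fin 2) (Fin 2) (LocalRing L v)).charpoly).map (Pi.evalRingHom (fun w' : PlacesOver L v => w'.1.adicCompletion L) w)) :=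
      Matrix.charpoly_map _ _
    have hαw : (((γH.1.val : GL (Fin 2) (LocalRing L v)).val.map (Pi.evalRingHom (fun w' : PlacesOver L v => w'.1.adicCompletion L) w))).charpoly.IsRoot α := by rw [hcm]; exact hα
    have hγw : (((γH.1.val : GL (Fin 2) (LocalRing L v)).val.map (Pi.evalRingHom (fun w' : PlacesOver L v => w'.1.adicCompletion L) w))).charpoly.IsRoot γ := by rw [hcm]; exact hγ
    -- the roots are `≡ 1 (mod ϖ_v²)` (2-deepness of `ι_v(γ_H)_w`, ★ p846644's integral-eigenvalue argument)
    have hfac := charpoly_map_endoEmbLocal_apply L w (γH := γH)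
    have hια : (((((endoEmbLocal L v γH).val : GL (Fin 3) (UnitaryGroup.LocalRing L v)) : Matrix (Fin 3) (Fin 3) (UnitaryGroup.LocalRing L v)).map (Pi.evalRingHom (fun w' : PlacesOver L v => w'.1.adicCompletion L) w))).charpoly.IsRoot α := by
      rw [hfac, Polynomial.IsRoot, eval_mul, hαw.eq_zero, zero_mul]
    have hιγ : (((((endoEmbLocal L v γH).val : GL (Fin 3) (UnitaryGroup.LocalRing L v)) : Matrix (Fin 3) (Fin 3) (UnitaryGroup.LocalRing L v)).map (Pi.evalRingHom (fun w' : PlacesOver L v => w'.1.adicCompletion L) w))).charpoly.IsRoot γ := by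
      rw [hfac, Polynomial.IsRoot, eval_mul, hγw.eq_zero, zero_mul]
    have hdeepι' : ∀ i j, Valued.v (((((endoEmbLocal L v γH).val : GL (Fin 3) (UnitaryGroup.LocalRing L v)) : Matrix (Fin 3) (Fin 3) (UnitaryGroup.LocalRing L v)).map (Pi.evalRingHom (fun w' : PlacesOver L v => w'.1.adicCompletion L) w)) i j - (1 : Matrix (Fin 3) (Fin 3) (w.1.adicCompletion L)) i j) ≤ Valued.v (c w ^ 2) := fun i j => by
      rw [hcc, ← Matrix.sub_apply]; exact hdeepι i j
    have hα2 : Valued.v (α - 1) ≤ WithZero.exp (-2 : ℤ) := by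
      rw [← hcc]; exact valued_sub_one_le_of_isRoot_charpoly_of_congr_one _ hcc0 hdeepι' hια
    have hγ2 : Valued.v (γ - 1) ≤ WithZero.exp (-2 : ℤ) := by
      rw [← hcc]; exact valued_sub_one_le_of_isRoot_charpoly_of_congr_one _ hcc0 hdeepι' hιγ
    have hα1 : Valued.v (α - 1) < 1 := lt_of_le_of_lt hα2 he2
    have hγ1 : Valued.v (γ - 1) < 1 := lt_of_le_of_lt hγ2 he2
    have hb1 : Valued.v (finGammaTwo L v γH w - 1) < 1 := lt_of_le_of_lt hu1e he1
    -- `N ≥ 2`, `N₁, N₂ ≥ 1`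
    have h2N : 2 ≤ N := by
      have h : Valued.v (α - γ) ≤ WithZero.exp (-2 : ℤ) := by
        rw [show α - γ = (α - 1) - (γ - 1) by ring]
        exact (Valuation.map_sub _ _ _).trans (max_le hα2 hγ2)
      rw [hN, WithZero.exp_le_exp] at h; omega
    have hN₁1 : 1 ≤ N₁ := by
      have h : Valued.v (α - finGammaTwo L v γH w) < 1 := by
        rw [show α - finGammaTwo L v γH w = (α - 1) - (finGammaTwo L v γH w - 1) by ring]
        exact lt_of_le_of_lt (Valuation.map_sub _ _ _) (max_lt hα1 hb1)
      rw [hN₁, ← WithZero.exp_zero, WithZero.exp_lt_exp] at h; omega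
    have hN₂1 : 1 ≤ N₂ := by
      have h : Valued.v (γ - finGammaTwo L v γH w) < 1 := by
        rw [show γ - finGammaTwo L v γH w = (γ - 1) - (finGammaTwo L v γH w - 1) by ring]
        exact lt_of_le_of_lt (Valuation.map_sub _ _ _) (max_lt hγ1 hb1)
      rw [hN₂, ← WithZero.exp_zero, WithZero.exp_lt_exp] at h; omega
    -- `|χ_g(u)|_w = exp(−(N₁ + N₂))`
    have Hob6 := trace_det_disc_of_isRoot_of_isRoot (((γH.1.val : GL (Fin 2) (LocalRing L v)).val.map (Pi.evalRingHom (fun w' : PlacesOver L v => w'.1.adicCompletion L) w))) hαw hγw hαγ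
    obtain ⟨htr, hdet, hdisc⟩ := Hob6
    have hn : Valued.v (((finCharpolyTwo L v γH).eval (finGammaTwo L v γH)) w) = WithZero.exp (-((N₁ + N₂ : ℕ) : ℤ)) := by
      rw [eval_finCharpolyTwo_finGammaTwo_apply_eq_quadratic]
      have e : finGammaTwo L v γH w ^ 2 - (((γH.1.val : GL (Fin 2) (LocalRing L v)).val.map (Pi.evalRingHom (fun w' : PlacesOver L v => w'.1.adicCompletion L) w))).trace * finGammaTwo L v γH w + (((γH.1.val : GL (Fin 2) (LocalRing L v)).val.map (Pi.evalRingHom (fun w' : PlacesOver L v => w'.1.adicCompletion L) w))).det =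
          (α - finGammaTwo L v γH w) * (γ - finGammaTwo L v γH w) := by rw [htr, hdet]; ring
      rw [show ((γH.1.val.val : Matrix (Fin 2) (Fin 2) (UnitaryGroup.LocalRing L v)).map
          (Pi.evalRingHom (fun w' : UnitaryGroup.PlacesOver L v => w'.1.adicCompletion L) w)) = (((γH.1.val : GL (Fin 2) (LocalRing L v)).val.map (Pi.evalRingHom (fun w' : PlacesOver L v => w'.1.adicCompletion L) w))) from rfl, e, map_mul, hN₁, hN₂,
        ← WithZero.exp_add]
      congr 1; push_cast; ring
    have hn2 : 2 ≤ N₁ + N₂ := by omega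
    -- the discriminant `(α − γ)²` is `< exp(−2)`
    have hdisclt : Valued.v ((((γH.1.val : GL (Fin 2) (LocalRing L v)).val.map (Pi.evalRingHom (fun w' : PlacesOver L v => w'.1.adicCompletion L) w))).trace ^ 2 - 4 * (((γH.1.val : GL (Fin 2) (LocalRing L v)).val.map (Pi.evalRingHom (fun w' : PlacesOver L v => w'.1.adicCompletion L) w))).det) < WithZero.exp (-2 : ℤ) := by
      rw [hdisc, map_pow, hN, ← WithZero.exp_nsmul, WithZero.exp_lt_exp, two_nsmul]; omega
    -- denominators and the shifted element `u_H = (s₁, s₂)`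
    have Hoc1 := isUnit_hermitianShift_denominators_of_twoDeep L v w hw γH hc hθ hθv hg2c' hu2c'
    obtain ⟨-, -, -, -, hU2m, hU2p, hU1s, -, hU1m', hU1p', hU3⟩ := Hoc1
    have Hob7 := exists_local_coe_eq_hermitianMoebius L v 2 (Matrix.of fun i j : Fin 2 => if i.val + j.val + 1 = 2 then (1 : L) else 0) γH.1 hσc hU2m hU2p
    obtain ⟨s₁, hs₁⟩ := Hob7
    have Hob8 := exists_local_coe_eq_hermitianMoebius L v 1 (Matrix.of fun i j : Fin 1 => if i.val + j.val + 1 = 1 then (1 : L) else 0) γH.2 hσc hU1m' hU1p'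
    obtain ⟨s₂, hs₂⟩ := Hob8
    have hu'eq := finGammaTwo_of_coe_eq_genMoebius L v γH (s₁, s₂) θ (c - θ) (conjLocal L (IsCMField.complexConj L) v θ) (c - conjLocal L (IsCMField.complexConj L) v θ) hs₂
    have Hoc2 :=
      hermitianShifted_binders_of_typeOne L v w hw γH (s₁, s₂) hσc hc θ hθ hθv hs₁ hu'eq hg1 hu1 α γ hα hγ hαγ N hN h2N hα2 hγ2 hn2 hn
    obtain ⟨hα', hγ', hαγ', hN', hα1', hγ1', hn', hreg'⟩ := Hoc2
    have hell' := not_levi_of_hermitianShift L v γH (s₁, s₂) θ hΔ hs₁ hU2m hnl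
    -- the two `S`-rows (★ p846474, type (1))
    have HS := stableOrbitalIntegralRel_chi_shift_of_isRoot L v w hw νH hv hmH hreg hnl α γ hα hγ hαγ N hN hα1 hγ1 hreg' hell'
      _ _ hα' hγ' hαγ' hN' hα1' hγ1' h2N
    -- compact centralisers of the matching classes of `γ_H` and of `u_H` (★ type-(1) supplier, F0P2-p02 (g12))
    have hcm' : ((((s₁, s₂).1.val : GL (Fin 2) (UnitaryGroup.LocalRing L v)).val.map
        (Pi.evalRingHom (fun w' : PlacesOver L v => w'.1.adicCompletion L) w)).charpoly) =
        ((((s₁, s₂).1.val : GL (Fin 2) (LocalRing L v)) : Matrix (Fin 2) (Fin 2) (LocalRing L v)).charpoly).map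
          (Pi.evalRingHom (fun w' : PlacesOver L v => w'.1.adicCompletion L) w) := Matrix.charpoly_map _ _
    have hsplit' : ∃ x : w.1.adicCompletion L, ((((s₁, s₂).1.val : GL (Fin 2) (UnitaryGroup.LocalRing L v)).val.map
        (Pi.evalRingHom (fun w' : PlacesOver L v => w'.1.adicCompletion L) w)).charpoly).IsRoot x := ⟨_, by rw [hcm']; exact hα'⟩
    have hZ : ∀ x : ((cmDatum L 3 H').Local v), IsLocalNormPair L H' v γH x → CompactSpace (Subgroup.centralizer ({x} : Set ((cmDatum L 3 H').Local v))) :=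
      fun x hx => compactSpace_centralizer_of_isLocalNormPair_of_isRoot L v H' w hw hH' hdetH hreg hroot hnl x hx
    have hZ' : ∀ x : ((cmDatum L 3 H').Local v), IsLocalNormPair L H' v (s₁, s₂) x → CompactSpace (Subgroup.centralizer ({x} : Set ((cmDatum L 3 H').Local v))) :=
      fun x hx => compactSpace_centralizer_of_isLocalNormPair_of_isRoot L v H' w hw hH' hdetH hreg' hsplit' hell' x hx
    -- the transport (★ (A3)) with `hF` = N3
    have hm : WithZero.log (Valued.v (((finCharpolyTwo L v (s₁, s₂)).eval (finGammaTwo L v (s₁, s₂))) w)) =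
        WithZero.log (Valued.v (((finCharpolyTwo L v γH).eval (finGammaTwo L v γH)) w)) + 2 := by
      rw [hn', hn, WithZero.log_exp, WithZero.log_exp]; push_cast; omega
    refine ⟨(s₁, s₂), H5 γH (s₁, s₂) hgj' huj' hU2m hU1s hs₁ hu'eq, hreg', ?_, ?_, ?_⟩
    · exact (HS (fun _ => inferInstance) (fun _ => inferInstance)).1
    · exact (HS (fun _ => inferInstance) (fun _ => inferInstance)).2
    exact finsum_finExplicitCollection_Δ_mul_eq_inv_sq_mul_finsum_hermitianShift L v H' w hw c θ γH (s₁, s₂) μ hμω hv hμ hσc hΔ hreg hreg'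
      hs₁ hs₂ hU2m hU1m' hU3 (hN3_of hU2p hU1p') hU1s hm _ _
      (fun x y hx hy => classOrbitalIntegral_levelOneIndicator_eq_hermitianShift L H' hH' hdetH w hw hv νG hmG c hcw θ hθ hθv γH (s₁, s₂) hreg hreg' hs₁ hs₂ hU2m hU1m'
        hdeepN3 hZ hZ' g hg hgK hginv c' hc' g' hg's hg'K hg'inv hg'c x y hx hy)
  · /- ───── TYPE (2): `χ_{g_w}` irreducible over `L_w` — EISENSTEIN-CENTRE CURRENCY ───── -/
    have Hob12 := valuation_quadratic_bounds_of_entrywise_deep (((γH.1.val : GL (Fin 2) (LocalRing L v)).val.map (Pi.evalRingHom (fun w' : PlacesOver L v => w'.1.adicCompletion L) w))) (finGammaTwo L v γH w) hg1e hu1e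
    obtain ⟨hχ, -, htr, hdet⟩ := Hob12
    have htr1 : Valued.v (((γH.1.val : GL (Fin 2) (LocalRing L v)).val.map (Pi.evalRingHom (fun w' : PlacesOver L v => w'.1.adicCompletion L) w))).trace ≤ 1 :=
      v_le_one_of_v_sub_lt_one (by rw [show (2 : w.1.adicCompletion L) = 1 + 1 by norm_num]; exact (Valuation.map_add _ _ _).trans (max_le (by rw [map_one]) (by rw [map_one])))
        (lt_of_le_of_lt htr he1)
    have hdet1 : Valued.v (((γH.1.val : GL (Fin 2) (LocalRing L v)).val.map (Pi.evalRingHom (fun w' : PlacesOver L v => w'.1.adicCompletion L) w))).det ≤ 1 := v_le_one_of_v_sub_lt_one (by rw [map_one]) (lt_of_le_of_lt hdet he1)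
    have hub : Valued.v (finGammaTwo L v γH w) ≤ 1 := v_le_one_of_v_sub_lt_one (by rw [map_one]) (lt_of_le_of_lt hu1e he1)
    have htr' : Valued.v ((((γH.1.val : GL (Fin 2) (LocalRing L v)).val.map (Pi.evalRingHom (fun w' : PlacesOver L v => w'.1.adicCompletion L) w))).trace - 2) < 1 := lt_of_le_of_lt htr he1
    have hdet' : Valued.v ((((γH.1.val : GL (Fin 2) (LocalRing L v)).val.map (Pi.evalRingHom (fun w' : PlacesOver L v => w'.1.adicCompletion L) w))).det - 1) < 1 := lt_of_le_of_lt hdet he1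
    -- (P2d-α) Eisenstein data of `γ_H` at `w`, and the exponent `n` of `|χ_g(u)|`
    have Hob11 := exists_eisensteinData_at_place L w hw hv hroot htr1 hdet1 hub hc
    obtain ⟨Θ, αΘ, βΘ, aΘ, bΘ, n, N, -, hΘd, hΘt, hrel, hn, hb, -, -⟩ := Hob11
    have hn2 : 2 ≤ n := by
      rw [← eval_finCharpolyTwo_finGammaTwo_apply_eq_quadratic, hn, WithZero.exp_le_exp] at hχ
      omega
    -- the admissible centre `(a, f, e′, N)` of `g_w` (★ g11), `N ≥ 2` by 2-deepness (§1)
    have Hob13 := exists_admissibleCentre_of_eisensteinBlock hc hΘd hΘt hrel hb hub htr1 hdet1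
    obtain ⟨a, f, e', ha, htf, hde, hf, he⟩ := Hob13
    have hcpow := valued_pow_of_valued_eq_exp_neg_one hc
    have hchi1 : Valued.v ((1 : w.1.adicCompletion L) - (((γH.1.val : GL (Fin 2) (LocalRing L v)).val.map (Pi.evalRingHom (fun w' : PlacesOver L v => w'.1.adicCompletion L) w))).trace + (((γH.1.val : GL (Fin 2) (LocalRing L v)).val.map (Pi.evalRingHom (fun w' : PlacesOver L v => w'.1.adicCompletion L) w))).det) ≤ Valued.v (c w) ^ 4 := by
      have hb2 : ∀ i j, Valued.v (((((γH.1.val : GL (Fin 2) (LocalRing L v)).val.map (Pi.evalRingHom (fun w' : PlacesOver L v => w'.1.adicCompletion L) w))) - 1) i j) ≤ WithZero.exp (-2 : ℤ) := fun i j => by rw [← hcc]; exact hg2w i j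
      have e : (1 : w.1.adicCompletion L) - (((γH.1.val : GL (Fin 2) (LocalRing L v)).val.map (Pi.evalRingHom (fun w' : PlacesOver L v => w'.1.adicCompletion L) w))).trace + (((γH.1.val : GL (Fin 2) (LocalRing L v)).val.map (Pi.evalRingHom (fun w' : PlacesOver L v => w'.1.adicCompletion L) w))).det = ((((γH.1.val : GL (Fin 2) (LocalRing L v)).val.map (Pi.evalRingHom (fun w' : PlacesOver L v => w'.1.adicCompletion L) w))) - 1).det := by
        simp [Matrix.det_fin_two, Matrix.trace_fin_two, Matrix.sub_apply]
        ring
      rw [e, Matrix.det_fin_two, hcpow, show (-((4 : ℕ) : ℤ)) = (-2 : ℤ) + (-2 : ℤ) by norm_num, WithZero.exp_add]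
      refine (Valuation.map_sub _ _ _).trans (max_le ?_ ?_)
      · rw [map_mul]; exact mul_le_mul' (hb2 0 0) (hb2 1 1)
      · rw [map_mul]; exact mul_le_mul' (hb2 0 1) (hb2 1 0)
    have h2N : 2 ≤ N := two_le_of_admissibleCentre_of_twoDeep hc (((γH.1.val : GL (Fin 2) (LocalRing L v)).val.map (Pi.evalRingHom (fun w' : PlacesOver L v => w'.1.adicCompletion L) w))) hchi1 hf he htf hde
    have hN1 : 1 ≤ N := by omega
    -- denominators (★ p853717, 2-deepness only) and the shifted element `u_H = (s₁, s₂)`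
    have Hoc3 := isUnit_hermitianShift_denominators_of_twoDeep L v w hw γH hc hθ hθv hg2c' hu2c'
    obtain ⟨hw2m, -, hw1m, -, hU2m, hU2p, hU1s, -, hU1m', hU1p', hU3⟩ := Hoc3
    have Hob14 := exists_local_coe_eq_hermitianMoebius L v 2 (Matrix.of fun i j : Fin 2 => if i.val + j.val + 1 = 2 then (1 : L) else 0) γH.1 hσc hU2m hU2p
    obtain ⟨s₁, hs₁⟩ := Hob14
    have Hob15 := exists_local_coe_eq_hermitianMoebius L v 1 (Matrix.of fun i j : Fin 1 => if i.val + j.val + 1 = 1 then (1 : L) else 0) γH.2 hσc hU1m' hU1p'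
    obtain ⟨s₂, hs₂⟩ := Hob15
    have hu'eq := finGammaTwo_of_coe_eq_genMoebius L v γH (s₁, s₂) θ (c - θ) (conjLocal L (IsCMField.complexConj L) v θ) (c - conjLocal L (IsCMField.complexConj L) v θ) hs₂
    -- binders of `u_H` (★ NoDisc): `|χ(u′)| = exp(−(n−2))`, no root, `G`-regular
    have Hob16 := hermitianShifted_binders_of_typeTwo_of_valued_denominators L v w hw γH (s₁, s₂) hc θ hθ hs₁ hu'eq hw2m hw1m hroot hn2 hn
    obtain ⟨hn', hirr', hreg'⟩ := Hob16
    -- `(s₁)_w = φ_θ(g_w)` and `γ₂(u_H)_w = ψ_θ(γ₂(γ_H)_w)`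
    have hs₁w : (((s₁, s₂).1.val : GL (Fin 2) (LocalRing L v)).val.map (Pi.evalRingHom (fun w' : PlacesOver L v => w'.1.adicCompletion L) w)) =
        (θ w • (((γH.1.val : GL (Fin 2) (LocalRing L v)).val.map (Pi.evalRingHom (fun w' : PlacesOver L v => w'.1.adicCompletion L) w))) + (c w - θ w) • (1 : Matrix (Fin 2) (Fin 2) (w.1.adicCompletion L))) *
          ((c w - σw (θ w)) • (((γH.1.val : GL (Fin 2) (LocalRing L v)).val.map (Pi.evalRingHom (fun w' : PlacesOver L v => w'.1.adicCompletion L) w))) + σw (θ w) • (1 : Matrix (Fin 2) (Fin 2) (w.1.adicCompletion L)))⁻¹ := by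
      rw [show (s₁, s₂).1 = s₁ from rfl, hs₁, map_genMoebius (Pi.evalRingHom (fun w' : PlacesOver L v => w'.1.adicCompletion L) w) _ _ _ _ _ hU2m, map_sub, map_sub]
      simp only [Pi.evalRingHom_apply, hσθw]
    have hs₂w : finGammaTwo L v (s₁, s₂) w = (θ w * finGammaTwo L v γH w + (c w - θ w)) / ((c w - σw (θ w)) * finGammaTwo L v γH w + σw (θ w)) := by
      have hmul : finGammaTwo L v (s₁, s₂) * ((c - conjLocal L (IsCMField.complexConj L) v θ) * finGammaTwo L v γH + conjLocal L (IsCMField.complexConj L) v θ) = θ * finGammaTwo L v γH + (c - θ) := by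
        rw [hu'eq, mul_assoc, Ring.inverse_mul_cancel _ hU1s, mul_one]
      have hmw := congrFun hmul w
      simp only [Pi.mul_apply, Pi.add_apply, Pi.sub_apply, hσθw] at hmw
      have hne : (c w - σw (θ w)) * finGammaTwo L v γH w + σw (θ w) ≠ 0 := fun h => by
        have e : ((c - conjLocal L (IsCMField.complexConj L) v θ) * finGammaTwo L v γH + conjLocal L (IsCMField.complexConj L) v θ) w = (c w - σw (θ w)) * finGammaTwo L v γH w + σw (θ w) := by
          simp only [Pi.mul_apply, Pi.add_apply, Pi.sub_apply, hσθw]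
        rw [e, h, map_zero] at hw1m; exact WithZero.zero_ne_coe hw1m
      rw [eq_div_iff hne]
      exact hmw
    -- level-1 bounds for `u_H` (★ P1 ∕ P1 ED. 2 with `j = 1`)
    have Hob17 := valued_hermitianMoebius_sub_one_le_of_level σw hθw hθv hc (((γH.1.val : GL (Fin 2) (LocalRing L v)).val.map (Pi.evalRingHom (fun w' : PlacesOver L v => w'.1.adicCompletion L) w))) (j := 1) le_rfl hg2c
    obtain ⟨hg1u, -⟩ := Hob17
    have Hob18 := MoebiusShift.valued_hermitianMoebius_scalar_sub_one_le_of_level σw hθw hθv hc (finGammaTwo L v γH w) (j := 1) le_rfl hu2c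
    obtain ⟨hu1u, -⟩ := Hob18
    rw [pow_one, ← hs₁w] at hg1u
    rw [pow_one, ← hs₂w] at hu1u
    have hg1u' : ∀ i j, Valued.v (((((s₁, s₂).1.val : GL (Fin 2) (LocalRing L v)).val.map (Pi.evalRingHom (fun w' : PlacesOver L v => w'.1.adicCompletion L) w)) - 1) i j) ≤ WithZero.exp (-1 : ℤ) := fun i j => by rw [← hc]; exact hg1u i j
    have hu1u' : Valued.v (finGammaTwo L v (s₁, s₂) w - 1) ≤ WithZero.exp (-1 : ℤ) := by rw [← hc]; exact hu1u
    have Hob19 := valuation_quadratic_bounds_of_entrywise_deep _ _ hg1u' hu1u'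
    obtain ⟨-, -, htru, hdetu⟩ := Hob19
    have htru' : Valued.v ((((s₁, s₂).1.val : GL (Fin 2) (LocalRing L v)).val.map (Pi.evalRingHom (fun w' : PlacesOver L v => w'.1.adicCompletion L) w)).trace - 2) < 1 := lt_of_le_of_lt htru he1
    have hdetu' : Valued.v ((((s₁, s₂).1.val : GL (Fin 2) (LocalRing L v)).val.map (Pi.evalRingHom (fun w' : PlacesOver L v => w'.1.adicCompletion L) w)).det - 1) < 1 := lt_of_le_of_lt hdetu he1
    -- the admissible centre of `(s₁)_w = φ_θ(g_w)` at depth `N − 1` (★ p853726 «CENTRE-SHIFT-θ»)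
    have Hob20 := hermitianMoebius_admissibleCentre (θ := θ w) (θ' := σw (θ w)) (c := c w) hθw hθv hc (((γH.1.val : GL (Fin 2) (LocalRing L v)).val.map (Pi.evalRingHom (fun w' : PlacesOver L v => w'.1.adicCompletion L) w))) hg2c' hN1 hf he htf hde
    rw [← hs₁w] at Hob20
    obtain ⟨ha₁, f₁, e₁', htf₁, hde₁, hf₁, he₁⟩ := Hob20
    -- compact centralisers (★ anisotropic torus, any residue characteristic)
    have hΦ₂ : (Matrix.of fun i j : Fin 2 => if i.val + j.val + 1 = 2 then (1 : L) else 0).det ≠ 0 := by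
      rw [Matrix.det_fin_two]; simp
    haveI := compactSpace_centralizer_cmDatum_two_of_not_exists_isRoot L v w hw hΦ₂ γH.1 hroot
    haveI := compactSpace_centralizer_cmDatum_two_of_not_exists_isRoot L v w hw hΦ₂ (s₁, s₂).1 hirr'
    have hZ : ∀ x : ((cmDatum L 3 H').Local v), IsLocalNormPair L H' v γH x → CompactSpace (Subgroup.centralizer ({x} : Set ((cmDatum L 3 H').Local v))) := fun x hx =>
      compactSpace_centralizer_of_isLocalNormPair_of_not_exists_isRoot_nonsplit L v w hw hH'u hreg hroot x hx
    have hZ' : ∀ x : ((cmDatum L 3 H').Local v), IsLocalNormPair L H' v (s₁, s₂) x → CompactSpace (Subgroup.centralizer ({x} : Set ((cmDatum L 3 H').Local v))) := fun x hx =>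
      compactSpace_centralizer_of_isLocalNormPair_of_not_exists_isRoot_nonsplit L v w hw hH'u hreg' hirr' x hx
    -- the two `S`-rows in centre currency (ROW 8 ★ p853676): `ValuativeRel` valuations against `ϖ' = c_w`
    have hϖ'c : (toPlace v w (HeckeCharacter.uniformizer ↥(maximalRealSubfield L) v : v.adicCompletion ↥(maximalRealSubfield L))) = c w := hcw.symm
    have haO : a ∈ 𝒪[w.1.adicCompletion L] := (Valuation.mem_integer_iff _ _).2 ((v_le_one_iff_valuation_le_one _).1 ha)
    have haO' : (θ w * a + (c w - θ w)) / ((c w - σw (θ w)) * a + σw (θ w)) ∈ 𝒪[w.1.adicCompletion L] :=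
      (Valuation.mem_integer_iff _ _).2 ((v_le_one_iff_valuation_le_one _).1 ha₁)
    have hfv : Valued.v f ≤ Valued.v ((toPlace v w (HeckeCharacter.uniformizer ↥(maximalRealSubfield L) v : v.adicCompletion ↥(maximalRealSubfield L))) ^ (N + 1)) := by rw [hϖ'c, map_pow]; exact hf
    have hev : Valued.v e' = Valued.v ((toPlace v w (HeckeCharacter.uniformizer ↥(maximalRealSubfield L) v : v.adicCompletion ↥(maximalRealSubfield L))) ^ (2 * N + 1)) := by rw [hϖ'c, map_pow]; exact he
    have hf₁v : Valued.v f₁ ≤ Valued.v ((toPlace v w (HeckeCharacter.uniformizer ↥(maximalRealSubfield L) v : v.adicCompletion ↥(maximalRealSubfield L))) ^ (N - 1 + 1)) := by rw [hϖ'c, map_pow]; exact hf₁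
    have he₁v : Valued.v e₁' = Valued.v ((toPlace v w (HeckeCharacter.uniformizer ↥(maximalRealSubfield L) v : v.adicCompletion ↥(maximalRealSubfield L))) ^ (2 * (N - 1) + 1)) := by rw [hϖ'c, map_pow]; exact he₁
    have hfO := (v_le_iff_valuation_le _ _).1 hfv
    have heO := (v_eq_iff_valuation_eq _ _).1 hev
    have hf₁O := (v_le_iff_valuation_le _ _).1 hf₁v
    have he₁O := (v_eq_iff_valuation_eq _ _).1 he₁v
    have HS := stableOrbitalIntegralRel_chi_shift_of_not_exists_isRoot_affine L v w hw νH hv hmH hreg hroot haO hfO heO htf hde htr' hdet' hreg' hirr'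
      haO' hf₁O he₁O htf₁ hde₁ htru' hdetu' h2N
    -- the transport (★ (A3)-θ) with `hF` = N3-θ
    have hm : WithZero.log (Valued.v (((finCharpolyTwo L v (s₁, s₂)).eval (finGammaTwo L v (s₁, s₂))) w)) =
        WithZero.log (Valued.v (((finCharpolyTwo L v γH).eval (finGammaTwo L v γH)) w)) + 2 := by
      rw [hn', hn, WithZero.log_exp, WithZero.log_exp]; omega
    refine ⟨(s₁, s₂), H5 γH (s₁, s₂) hgj' huj' hU2m hU1s hs₁ hu'eq, hreg', ?_, ?_, ?_⟩
    · exact (HS (fun _ => inferInstance) (fun _ => inferInstance)).1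
    · exact (HS (fun _ => inferInstance) (fun _ => inferInstance)).2
    exact finsum_finExplicitCollection_Δ_mul_eq_inv_sq_mul_finsum_hermitianShift L v H' w hw c θ γH (s₁, s₂) μ hμω hv hμ hσc hΔ hreg hreg'
      hs₁ hs₂ hU2m hU1m' hU3 (hN3_of hU2p hU1p') hU1s hm _ _
      (fun x y hx hy => classOrbitalIntegral_levelOneIndicator_eq_hermitianShift L H' hH' hdetH w hw hv νG hmG c hcw θ hθ hθv γH (s₁, s₂) hreg hreg' hs₁ hs₂ hU2m hU1m'
        hdeepN3 hZ hZ' g hg hgK hginv c' hc' g' hg's hg'K hg'inv hg'c x y hx hy)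

end Literature.NumberTheory.Rogawski1990

end
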